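import Literature.Computability.AlgebraicComplexity.StandardFamilies
import Literature.Computability.AlgebraicComplexity.ArithCircuitComposition
import Literature.Computability.AlgebraicComplexity.CircuitDepthProductDepthOne
import HarnessLib
import HarnessLib.Audit

/-!
# DepthWindow / SuccinctLift — the divide-and-conquer UPPER bound for `IMM`: product depth
`⌈log₂ d⌉ + 1`, at most `(2n² + n + 2)^{⌈log₂ d⌉+1}` gates, over any commutative semiring

Decomposition workshop decomp-valiant, lens 2 (gen 33), CALLED offer O7 (critic bus 898), STAGE 1:
a reusable upper-bound calibration of the A-cell (route `DepthWindow`, crux item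
stmt-ValiantsHypothesis-30635) and the one explicit construction needed by the refutation of
homogenisation below slope `2` over `ℂ` (STAGE 2, `not_homAt_of_lt_two`; census cell W34, field
«lost factor 2 / ceiling_lift (a)»).  The tree so far only had LOWER bounds for `immPoly`.

Content (folklore; Bürgisser 2000, Ch. 2, Rem. 2.7 "all intermediate results at no extra cost";
LST 2021, §1 "IMM has small circuits of product-depth `log d`"): every entry of the product of a
nonempty segment of `≤ 2^e` generic `n × n` matrices is computed by a circuit of product depth `≤ e`
with `≤ dcSize n e ≤ (2n²+n+2)^e` gates (`exists_circuit_segProd_entry`: induction on `e`, one `ΣΠ`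
bilinear layer per level — `sumOfMonomials` of `Σ_m Y_{(0,i,m)} Y_{(1,m,j)}` — composed with the
circuits of the two halves by `ArithCircuit.compose`), and the trace costs one more `ΣΠ` layer:
`exists_circuit_immPoly : 1 ≤ d ≤ 2^e → ∃ C, C.Computes (immPoly n d k) ∧ C.productDepth ≤ e + 1 ∧
C.size ≤ (2n²+n+2)^(e+1)`.  No sharing between entries is attempted (the bound `n^{O(log d)}` is
what STAGE 2 needs: any `n^{polylog d}` start is absorbed against LST's `n^{d^{Ω(1)}}`).

References: Burgisser2000 (Def. 2.1, Rem. 2.7); LimayeSrinivasanTavenas2021 (§1, §2).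
-/

noncomputable section

open MvPolynomial

-- the summit and the problem share the name `ValiantsHypothesis` (D-0017 single-conjunct layout)
set_option linter.dupNamespace false

namespace Summit.ValiantsHypothesis.ValiantsHypothesis.Theorems.DepthWindowImmDivideConquer

open Literature.Computability.AlgebraicComplexity ArithCircuit

universe u

variable (k : Type u) [CommSemiring k] (n d : ℕ)

/-- The `t`-th generic `n × n` matrix `X⁽ᵗ⁾ = (X_{(t,i,j)})ᵢⱼ` over the `d n²` variables of `IMM_{n,d}`.
[cite: LimayeSrinivasanTavenas2021, §2] -/
def genMatrix (t : Fin d) : Matrix (Fin n) (Fin n) (MvPolynomial (Fin d × Fin n × Fin n) k) :=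
  (Matrix.mvPolynomialX (Fin n) (Fin n) k).map (rename fun ij : Fin n × Fin n => (t, ij))

/-- The ordered product of the generic matrices along a list of layers.
[cite: LimayeSrinivasanTavenas2021, §2] -/
def segProd (l : List (Fin d)) : Matrix (Fin n) (Fin n) (MvPolynomial (Fin d × Fin n × Fin n) k) :=
  (l.map (genMatrix k n d)).prod

variable {k n d}

/-- Entries of a generic matrix are variables. [cite: LimayeSrinivasanTavenas2021, §2] -/
theorem genMatrix_apply (t : Fin d) (i j : Fin n) : genMatrix k n d t i j = X (t, i, j) := by
  simp [genMatrix, Matrix.map_apply, Matrix.mvPolynomialX, rename_X]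

/-- `IMM_{n,d}` is the trace of the full segment product. [cite: LimayeSrinivasanTavenas2021, §2] -/
theorem immPoly_eq_trace_segProd : immPoly n d k = (segProd k n d (List.finRange d)).trace := rfl

/-- Segment products are multiplicative under concatenation. [cite: LimayeSrinivasanTavenas2021, §2] -/
theorem segProd_append (l₁ l₂ : List (Fin d)) :
    segProd k n d (l₁ ++ l₂) = segProd k n d l₁ * segProd k n d l₂ := by
  simp [segProd, List.map_append, List.prod_append]

/-- A one-layer segment product is the generic matrix. [cite: LimayeSrinivasanTavenas2021, §2] -/
theorem segProd_singleton (t : Fin d) : segProd k n d [t] = genMatrix k n d t := by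
  simp [segProd]

/-- The gate budget of the divide-and-conquer circuit at level `e`:
`B₀ = 0`, `B_{e+1} = n + 1 + (2n² + 1) B_e`. [cite: Burgisser2000, Rem. 2.7] -/
def dcSize (n : ℕ) : ℕ → ℕ
  | 0 => 0
  | e + 1 => n + 1 + (2 * n * n + 1) * dcSize n e

/-- The budget is monotone in the level. [cite: Burgisser2000, Rem. 2.7] -/
theorem dcSize_le_succ (n e : ℕ) : dcSize n e ≤ dcSize n (e + 1) := by
  show dcSize n e ≤ n + 1 + (2 * n * n + 1) * dcSize n e
  have h : dcSize n e ≤ (2 * n * n + 1) * dcSize n e := Nat.le_mul_of_pos_left _ (Nat.succ_pos _)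
  exact h.trans (Nat.le_add_left _ _)

/-- Closed-form bound `B_e ≤ (2n² + n + 2)^e`. [cite: Burgisser2000, Rem. 2.7] -/
theorem dcSize_le_pow (n e : ℕ) : dcSize n e ≤ (2 * n * n + n + 2) ^ e := by
  induction e with
  | zero => simp [dcSize]
  | succ e ih =>
    show n + 1 + (2 * n * n + 1) * dcSize n e ≤ (2 * n * n + n + 2) ^ (e + 1)
    have h1 : 0 < (2 * n * n + n + 2) ^ e := pow_pos (by omega) e
    calc n + 1 + (2 * n * n + 1) * dcSize n e
        ≤ (n + 1) * (2 * n * n + n + 2) ^ e + (2 * n * n + 1) * (2 * n * n + n + 2) ^ e :=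
          Nat.add_le_add (Nat.le_mul_of_pos_right _ h1) (Nat.mul_le_mul_left _ ih)
      _ = (n + 1 + (2 * n * n + 1)) * (2 * n * n + n + 2) ^ e := (Nat.add_mul _ _ _).symm
      _ = (2 * n * n + n + 2) * (2 * n * n + n + 2) ^ e := by
          congr 1; omega
      _ = (2 * n * n + n + 2) ^ (e + 1) := (pow_succ' _ _).symm

/-- The input circuit reading one variable: no gates, product depth `0`.
[cite: Burgisser2000, Def. 2.1] -/
theorem exists_circuit_X {σ : Type*} (v : σ) :
    ∃ C : ArithCircuit k σ, C.Computes (X v) ∧ C.productDepth ≤ 0 ∧ C.size ≤ 0 :=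
  ⟨⟨[], .var v⟩, rfl, le_of_eq rfl, le_of_eq rfl⟩

/-- The bilinear form `Σ_m Y_{(0,i,m)} Y_{(1,m,j)}` of one matrix-product entry, over the `2n²`
auxiliary variables `Fin 2 × Fin n × Fin n`. [cite: Burgisser2000, Rem. 2.7] -/
def mulEntryPoly (k : Type u) [CommSemiring k] (n : ℕ) (i j : Fin n) :
    MvPolynomial (Fin 2 × Fin n × Fin n) k :=
  ∑ m : Fin n, X ((0 : Fin 2), i, m) * X ((1 : Fin 2), m, j)

/-- The bilinear form of one entry has at most `n` monomials. [cite: Burgisser2000, Rem. 2.7] -/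
theorem card_support_mulEntryPoly_le (i j : Fin n) :
    (mulEntryPoly k n i j).support.card ≤ n := by
  classical
  unfold mulEntryPoly
  calc (∑ m : Fin n, X ((0 : Fin 2), i, m) * X ((1 : Fin 2), m, j) :
          MvPolynomial (Fin 2 × Fin n × Fin n) k).support.card
      ≤ (Finset.univ.biUnion fun m : Fin n =>
          (X ((0 : Fin 2), i, m) * X ((1 : Fin 2), m, j) :
            MvPolynomial (Fin 2 × Fin n × Fin n) k).support).card :=
        Finset.card_le_card (support_sum ..)
    _ ≤ ∑ m : Fin n, (X ((0 : Fin 2), i, m) * X ((1 : Fin 2), m, j) :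
            MvPolynomial (Fin 2 × Fin n × Fin n) k).support.card := Finset.card_biUnion_le
    _ ≤ ∑ _m : Fin n, 1 := Finset.sum_le_sum fun m _ => by
        rw [X, X, monomial_mul]
        exact (Finset.card_le_card support_monomial_subset).trans (by simp)
    _ = n := by simp

/-- A `ΣΠ` circuit for one matrix-product entry: product depth `≤ 1`, `≤ n + 1` gates.
[cite: LimayeSrinivasanTavenas2021, §1] -/
theorem exists_circuit_mulEntryPoly (i j : Fin n) :
    ∃ P : ArithCircuit k (Fin 2 × Fin n × Fin n), P.Computes (mulEntryPoly k n i j) ∧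
      P.productDepth ≤ 1 ∧ P.size ≤ n + 1 := by
  classical
  refine ⟨sumOfMonomials (mulEntryPoly k n i j).support.toList (mulEntryPoly k n i j),
    computes_sumOfMonomials (Finset.nodup_toList _) (fun m hm => Finset.mem_toList.mpr hm),
    productDepth_sumOfMonomials_le _ _, ?_⟩
  rw [size_sumOfMonomials, Finset.length_toList]
  exact Nat.add_le_add_right (card_support_mulEntryPoly_le i j) 1

/-- **Divide and conquer.** Every entry of the product of a nonempty segment of at most `2^e`
generic matrices has a circuit of product depth `≤ e` with at most `dcSize n e` gates.
[cite: Burgisser2000, Rem. 2.7] [cite: LimayeSrinivasanTavenas2021, §1] -/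
theorem exists_circuit_segProd_entry (e : ℕ) :
    ∀ l : List (Fin d), 0 < l.length → l.length ≤ 2 ^ e → ∀ i j : Fin n,
      ∃ C : ArithCircuit k (Fin d × Fin n × Fin n),
        C.Computes (segProd k n d l i j) ∧ C.productDepth ≤ e ∧ C.size ≤ dcSize n e := by
  classical
  induction e with
  | zero =>
    intro l hl hle i j
    obtain ⟨t, rfl⟩ : ∃ t, l = [t] := by
      match l, hl, hle with
      | [t], _, _ => exact ⟨t, rfl⟩
    rw [segProd_singleton, genMatrix_apply]
    exact exists_circuit_X (k := k) (t, i, j)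
  | succ e ih =>
    intro l hl hle i j
    by_cases hsmall : l.length ≤ 2 ^ e
    · obtain ⟨C, hC, hCd, hCs⟩ := ih l hl hsmall i j
      exact ⟨C, hC, hCd.trans (Nat.le_succ e), hCs.trans (dcSize_le_succ n e)⟩
    rw [not_le] at hsmall
    set l₁ := l.take (2 ^ e) with hl₁
    set l₂ := l.drop (2 ^ e) with hl₂
    have hl₁len : l₁.length = 2 ^ e := by
      rw [hl₁, List.length_take]; omega
    have hl₂len : l₂.length = l.length - 2 ^ e := by rw [hl₂, List.length_drop]
    have h1pos : 0 < l₁.length := by rw [hl₁len]; exact Nat.two_pow_pos e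
    have h2pos : 0 < l₂.length := by rw [hl₂len]; omega
    have h2le : l₂.length ≤ 2 ^ e := by rw [hl₂len, pow_succ] at *; omega
    have hsplit : segProd k n d l = segProd k n d l₁ * segProd k n d l₂ := by
      rw [← segProd_append, hl₁, hl₂, List.take_append_drop]
    -- circuits for all entries of the two halves
    have ih₁ : ∀ ab : Fin n × Fin n, ∃ C : ArithCircuit k (Fin d × Fin n × Fin n),
        C.Computes (segProd k n d l₁ ab.1 ab.2) ∧ C.productDepth ≤ e ∧ C.size ≤ dcSize n e :=
      fun ab => ih l₁ h1pos hl₁len.le ab.1 ab.2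
    have ih₂ : ∀ ab : Fin n × Fin n, ∃ C : ArithCircuit k (Fin d × Fin n × Fin n),
        C.Computes (segProd k n d l₂ ab.1 ab.2) ∧ C.productDepth ≤ e ∧ C.size ≤ dcSize n e :=
      fun ab => ih l₂ h2pos h2le ab.1 ab.2
    choose C₁ hC₁ using ih₁
    choose C₂ hC₂ using ih₂
    obtain ⟨P, hP, hPd, hPs⟩ := exists_circuit_mulEntryPoly (k := k) (n := n) i j
    -- the substitution: left-half entries for `Y_{(0,·,·)}`, right-half entries for `Y_{(1,·,·)}`
    let Q : Fin 2 × Fin n × Fin n → ArithCircuit k (Fin d × Fin n × Fin n) :=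
      fun x => if x.1 = 0 then C₁ x.2 else C₂ x.2
    let g : Fin 2 × Fin n × Fin n → MvPolynomial (Fin d × Fin n × Fin n) k :=
      fun x => if x.1 = 0 then segProd k n d l₁ x.2.1 x.2.2 else segProd k n d l₂ x.2.1 x.2.2
    have hQ : ∀ x, (Q x).Computes (g x) := by
      rintro ⟨b, a, c⟩
      by_cases hb : b = 0
      · simp only [Q, g, hb, if_true]; exact (hC₁ (a, c)).1
      · simp only [Q, g, hb, if_false]; exact (hC₂ (a, c)).1
    have hQd : ∀ x, (Q x).productDepth ≤ e := by
      rintro ⟨b, ac⟩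
      by_cases hb : b = 0
      · simp only [Q, hb, if_true]; exact (hC₁ ac).2.1
      · simp only [Q, hb, if_false]; exact (hC₂ ac).2.1
    have hQs : ∀ x, (Q x).size ≤ dcSize n e := by
      rintro ⟨b, ac⟩
      by_cases hb : b = 0
      · simp only [Q, hb, if_true]; exact (hC₁ ac).2.2
      · simp only [Q, hb, if_false]; exact (hC₂ ac).2.2
    refine ⟨P.compose Q, ?_, ?_, ?_⟩
    · -- semantics
      have hc := Computes.compose hP hQ
      have hval : aeval g (mulEntryPoly k n i j) = segProd k n d l i j := by
        rw [hsplit, Matrix.mul_apply, mulEntryPoly, map_sum]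
        refine Finset.sum_congr rfl fun m _ => ?_
        rw [map_mul, aeval_X, aeval_X]
        simp [g]
      rwa [hval] at hc
    · -- product depth
      calc (P.compose Q).productDepth ≤ P.productDepth + e := productDepth_compose_le hQd P
        _ ≤ 1 + e := Nat.add_le_add_right hPd e
        _ = e + 1 := Nat.add_comm 1 e
    · -- size
      rw [size_compose]
      calc P.size + ∑ x, (Q x).size
          ≤ (n + 1) + ∑ _x : Fin 2 × Fin n × Fin n, dcSize n e :=
            Nat.add_le_add hPs (Finset.sum_le_sum fun x _ => hQs x)
        _ = n + 1 + 2 * n * n * dcSize n e := by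
            rw [Finset.sum_const, Finset.card_univ, smul_eq_mul]
            simp only [Fintype.card_prod, Fintype.card_fin]
            ring
        _ ≤ dcSize n (e + 1) := by
            show n + 1 + 2 * n * n * dcSize n e ≤ n + 1 + (2 * n * n + 1) * dcSize n e
            exact Nat.add_le_add_left (Nat.mul_le_mul_right _ (Nat.le_succ _)) _

/-- The linear form `Σ_i Z_i` (the trace pattern) over `n` auxiliary variables has at most `n`
monomials. [cite: Burgisser2000, Rem. 2.7] -/
theorem card_support_sum_X_le :
    ((∑ i : Fin n, X i : MvPolynomial (Fin n) k)).support.card ≤ n := by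
  classical
  calc ((∑ i : Fin n, X i : MvPolynomial (Fin n) k)).support.card
      ≤ (Finset.univ.biUnion fun i : Fin n => (X i : MvPolynomial (Fin n) k).support).card :=
        Finset.card_le_card (support_sum ..)
    _ ≤ ∑ i : Fin n, (X i : MvPolynomial (Fin n) k).support.card := Finset.card_biUnion_le
    _ ≤ ∑ _i : Fin n, 1 := Finset.sum_le_sum fun i _ => by
        rw [X]
        exact (Finset.card_le_card support_monomial_subset).trans (by simp)
    _ = n := by simp

/-- **The divide-and-conquer circuit for `IMM_{n,d}`.**  For `1 ≤ d ≤ 2^e`, the iterated matrix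
multiplication polynomial `IMM_{n,d}` over any commutative semiring has a circuit of product depth
`≤ e + 1` with at most `(2n² + n + 2)^{e+1}` gates (balanced binary splitting of the matrix word,
one `ΣΠ` layer per level, one more for the trace).  [cite: Burgisser2000, Rem. 2.7]
[cite: LimayeSrinivasanTavenas2021, §1] -/
theorem exists_circuit_immPoly (k : Type u) [CommSemiring k] (n : ℕ) {d e : ℕ} (hd : 1 ≤ d)
    (hde : d ≤ 2 ^ e) :
    ∃ C : ArithCircuit k (Fin d × Fin n × Fin n), C.Computes (immPoly n d k) ∧
      C.productDepth ≤ e + 1 ∧ C.size ≤ (2 * n * n + n + 2) ^ (e + 1) := by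
  classical
  have hlen : (List.finRange d).length = d := List.length_finRange
  have hfull : ∀ i : Fin n, ∃ C : ArithCircuit k (Fin d × Fin n × Fin n),
      C.Computes (segProd k n d (List.finRange d) i i) ∧ C.productDepth ≤ e ∧
        C.size ≤ dcSize n e :=
    fun i => exists_circuit_segProd_entry e (List.finRange d) (by rw [hlen]; exact hd)
      (by rw [hlen]; exact hde) i i
  choose Cf hCf using hfull
  set f : MvPolynomial (Fin n) k := ∑ i : Fin n, X i with hf
  obtain ⟨P, hP, hPd, hPs⟩ : ∃ P : ArithCircuit k (Fin n), P.Computes f ∧ P.productDepth ≤ 1 ∧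
      P.size ≤ n + 1 := by
    refine ⟨sumOfMonomials f.support.toList f,
      computes_sumOfMonomials (Finset.nodup_toList _) (fun m hm => Finset.mem_toList.mpr hm),
      productDepth_sumOfMonomials_le _ _, ?_⟩
    rw [size_sumOfMonomials, Finset.length_toList, hf]
    exact Nat.add_le_add_right card_support_sum_X_le 1
  refine ⟨P.compose Cf, ?_, ?_, ?_⟩
  · have hc := Computes.compose hP fun i => (hCf i).1
    have hval : aeval (fun i => segProd k n d (List.finRange d) i i) f = immPoly n d k := by
      rw [immPoly_eq_trace_segProd, Matrix.trace, hf, map_sum]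
      refine Finset.sum_congr rfl fun i _ => ?_
      rw [aeval_X, Matrix.diag]
    rwa [hval] at hc
  · calc (P.compose Cf).productDepth ≤ P.productDepth + e :=
          productDepth_compose_le (fun i => (hCf i).2.1) P
      _ ≤ 1 + e := Nat.add_le_add_right hPd e
      _ = e + 1 := Nat.add_comm 1 e
  · rw [size_compose]
    calc P.size + ∑ i, (Cf i).size ≤ (n + 1) + ∑ _i : Fin n, dcSize n e :=
          Nat.add_le_add hPs (Finset.sum_le_sum fun i _ => (hCf i).2.2)
      _ = n + 1 + n * dcSize n e := by
          rw [Finset.sum_const, Finset.card_univ, smul_eq_mul, Fintype.card_fin]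
      _ ≤ dcSize n (e + 1) := by
          show n + 1 + n * dcSize n e ≤ n + 1 + (2 * n * n + 1) * dcSize n e
          have hn : n ≤ 2 * n * n + 1 :=
            (Nat.le_mul_self n).trans (by rw [Nat.mul_assoc]; omega)
          exact Nat.add_le_add_left (Nat.mul_le_mul_right _ hn) _
      _ ≤ (2 * n * n + n + 2) ^ (e + 1) := dcSize_le_pow n (e + 1)

end Summit.ValiantsHypothesis.ValiantsHypothesis.Theorems.DepthWindowImmDivideConquer
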